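import Literature.Analysis.UnboundedOperators.ConjugateOperatorRegularity
import HarnessLib

/-!
# The virial theorem of conjugate-operator (Mourre) theory, `C¹(A)` form

Topic `Literature/Analysis/UnboundedOperators` (on top of `ConjugateOperatorRegularity`, which
records the class `C¹(A; H)` through `HasCommutator A S D` — "`x ↦ e^{-iAx} S e^{iAx}` has strong
derivative `D = [S, iA]` at `0`" — and deliberately leaves every THEOREM of Mourre theory out).

## Contents

* `tendsto_appReal_apply_of_tendsto` — `W(t) z(t) → z₀` when `z(t) → z₀`, `t → 0`;
* `HasCommutator.tendsto_inv_smul_sub` — the one-sided form of the commutator,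
  `[S, iA] f = lim_{x → 0} x⁻¹ (S W(x) f - W(x) S f)` (ABG's `[S, A_τ] → [S, A]`,
  `A_τ = (iτ)⁻¹ (e^{iAτ} - 1)`);
* **the virial theorem** in the bounded form that is the core of ABG Prop. 7.2.10:
  if `S ∈ C¹(A; H)` with `[S, iA] = D`, `S f₂ = c f₂` and `S* f₁ = c̄ f₁` (written
  `⟪f₁, S x⟫ = c ⟪f₁, x⟫`), then `⟪f₁, D f₂⟫ = 0`
  (`HasCommutator.inner_eq_zero_of_eigenvector`, and the `adjoint` phrasing);
* its instances for a strongly continuous one-parameter unitary group `U(t) = e^{itH}`: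
  invariant vectors (`Ker H`, frequency `0`) kill the commutator of every `U(t) ∈ C¹(A; H)`
  (`inner_eq_zero_of_mem_invariantVectors_appReal`), of every smeared operator
  `∫ k(a) U(a) da ∈ C¹(A; H)` (`…_smear`), and in particular of the resolvent `(H + i)⁻¹` when `H`
  is of class `C¹(A)` (`inner_commutator_resolventNegI_eq_zero`: ABG Prop. 7.2.10 at the
  eigenvalue `λ = 0`, `E({0}) [A, (H+i)⁻¹] E({0}) = 0`, with `E({0})H = invariantVectors U`);
  and eigenvectors of a single `U(t)` at any eigenvalue (`…_of_appReal_apply_eq_smul`, the virial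
  theorem for unitary operators used in Floquet / Koopman Mourre theory).

## What is NOT here

* The full statement of ABG Prop. 7.2.10 for an eigenvalue `λ ≠ 0` of the unbounded `H`
  (needs `(H - λ ∓ i)⁻¹`, i.e. resolvents at other points than the tree's `resolventNegI`), and its
  corollaries (finiteness of point spectrum under a Mourre estimate, ABG Cor. 7.2.11; the
  `(A, N)`-regular / `C¹(A; 𝒢, 𝒢*)` variants ABG Prop. 7.5.1, Georgescu–Gérard–Møller 2004).

## References

* W. O. Amrein, A. Boutet de Monvel, V. Georgescu, *C₀-Groups, Commutator Methods and Spectral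
  Theory of N-Body Hamiltonians* (1996), Prop. 7.2.10 (virial theorem) and its proof.
* E. Mourre, Comm. Math. Phys. 78 (1981) 391–408, Prop. II.4 (the original virial theorem).
-/

noncomputable section

open Filter Set
open _root_.MeasureTheory _root_.Complex
open scoped InnerProductSpace ComplexConjugate
open scoped _root_.Topology

namespace Literature.Analysis.UnboundedOperators

namespace UnitaryRep

variable {H : Type*} [NormedAddCommGroup H] [InnerProductSpace ℂ H] [CompleteSpace H]

/-! ## Two limits -/

/-- If `z(t) → z₀` as `t → 0` (along `l ≤ 𝓝 0`) then `W(t) z(t) → z₀`: isometry plus strong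
continuity of the one-parameter unitary group `W`. [folklore] -/
theorem tendsto_appReal_apply_of_tendsto (A : OneParameterUnitaryGroup H) {l : Filter ℝ}
    (hl : l ≤ 𝓝 0) {z : ℝ → H} {z₀ : H} (hz : Tendsto z l (𝓝 z₀)) :
    Tendsto (fun t => A.appReal t (z t)) l (𝓝 z₀) := by
  rw [tendsto_iff_norm_sub_tendsto_zero] at hz ⊢
  have h2 : Tendsto (fun t : ℝ => ‖A.appReal t z₀ - z₀‖) l (𝓝 0) := by
    have hc : Continuous fun t : ℝ => ‖A.appReal t z₀ - z₀‖ := by fun_prop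
    have := hc.tendsto 0
    simp only [appReal_zero, one_apply_eq_self, sub_self, norm_zero] at this
    exact this.mono_left hl
  refine squeeze_zero (fun t => norm_nonneg _) (fun t => ?_) (by simpa using hz.add h2)
  calc ‖A.appReal t (z t) - z₀‖
      = ‖A.appReal t (z t - z₀) + (A.appReal t z₀ - z₀)‖ := by
        congr 1; simp only [map_sub]; abel
    _ ≤ ‖A.appReal t (z t - z₀)‖ + ‖A.appReal t z₀ - z₀‖ := norm_add_le _ _
    _ = ‖z t - z₀‖ + ‖A.appReal t z₀ - z₀‖ := by rw [norm_appReal]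

/-- **The commutator as a one-sided limit**: if `x ↦ e^{-iAx} S e^{iAx}` has strong derivative
`D = [S, iA]` at `0`, then `x⁻¹ (S W(x) f - W(x) S f) → D f` as `x → 0`, `x ≠ 0` — multiply the
difference quotient of `𝒲(x)[S] f` by `W(x) → 1` (ABG: `[S, A] = lim_τ [S, A_τ]` with
`A_τ = (iτ)⁻¹ (e^{iAτ} - 1)`, the form used in the proof of Prop. 7.2.10).
[cite: AmreinBoutetdeMonvelGeorgescu1996, proof of Prop. 7.2.10] -/
theorem HasCommutator.tendsto_inv_smul_sub {A : OneParameterUnitaryGroup H} {S D : H →L[ℂ] H}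
    (h : A.HasCommutator S D) (f : H) :
    Tendsto (fun x : ℝ => (x⁻¹ : ℝ) • (S (A.appReal x f) - A.appReal x (S f))) (𝓝[≠] 0)
      (𝓝 (D f)) := by
  have h1 : Tendsto (fun x : ℝ => (x⁻¹ : ℝ) • (A.conjAut x S f - S f)) (𝓝[≠] 0) (𝓝 (D f)) := by
    simpa [conjAut_zero] using (h f).tendsto_slope_zero
  have h2 := A.tendsto_appReal_apply_of_tendsto (l := 𝓝[≠] (0 : ℝ)) nhdsWithin_le_nhds h1
  refine h2.congr fun x => ?_
  simp only [ContinuousLinearMap.map_smul_of_tower, map_sub, conjAut_apply,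
    appReal_apply_appReal_neg]

/-! ## The virial theorem (bounded / `C¹(A; H)` form) -/

/-- **Virial theorem, `C¹(A; H)` form** (the computation proving ABG Prop. 7.2.10): let
`S ∈ C¹(A; H)` with commutator `D = [S, iA]`, let `S f₂ = c f₂` and `S* f₁ = c̄ f₁`, the latter
written as `⟪f₁, S x⟫ = c ⟪f₁, x⟫` for all `x`. Then `⟪f₁, [S, iA] f₂⟫ = 0`. Proof:
`⟪f₁, (S W(x) - W(x) S) f₂⟫ = c ⟪f₁, W(x) f₂⟫ - c ⟪f₁, W(x) f₂⟫ = 0` for every `x`, and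
`x⁻¹ (S W(x) - W(x) S) f₂ → D f₂`. (ABG apply it to `S = (H + i)⁻¹`, `c = (λ + i)⁻¹`.)
[cite: AmreinBoutetdeMonvelGeorgescu1996, Prop. 7.2.10] -/
theorem HasCommutator.inner_eq_zero_of_eigenvector {A : OneParameterUnitaryGroup H}
    {S D : H →L[ℂ] H} (h : A.HasCommutator S D) {f₁ f₂ : H} {c : ℂ} (hf₂ : S f₂ = c • f₂)
    (hf₁ : ∀ x : H, ⟪f₁, S x⟫_ℂ = c * ⟪f₁, x⟫_ℂ) : ⟪f₁, D f₂⟫_ℂ = 0 := by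
  -- the regularised commutators have vanishing matrix element, identically in `x`
  have key : ∀ x : ℝ, ⟪f₁, (x⁻¹ : ℝ) • (S (A.appReal x f₂) - A.appReal x (S f₂))⟫_ℂ = 0 := by
    intro x
    rw [RCLike.real_smul_eq_coe_smul (K := ℂ), inner_smul_right, inner_sub_right, hf₁, hf₂, map_smul,
      inner_smul_right, sub_self, mul_zero]
  have hlim := Filter.Tendsto.inner (𝕜 := ℂ) (tendsto_const_nhds (x := f₁)) (h.tendsto_inv_smul_sub f₂)
  simp only [key] at hlim
  exact (tendsto_nhds_unique tendsto_const_nhds hlim).symm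

/-- The same virial theorem with the hypothesis on `f₁` phrased through the adjoint:
`S f₂ = c f₂`, `S† f₁ = c̄ f₁` (`f₁, f₂` eigenvectors of a normal `S` for the same eigenvalue, e.g.
`f₁ = f₂`) imply `⟪f₁, [S, iA] f₂⟫ = 0`. [cite: AmreinBoutetdeMonvelGeorgescu1996, Prop. 7.2.10] -/
theorem HasCommutator.inner_eq_zero_of_adjoint_eigenvector {A : OneParameterUnitaryGroup H}
    {S D : H →L[ℂ] H} (h : A.HasCommutator S D) {f₁ f₂ : H} {c : ℂ} (hf₂ : S f₂ = c • f₂)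
    (hf₁ : ContinuousLinearMap.adjoint S f₁ = conj c • f₁) : ⟪f₁, D f₂⟫_ℂ = 0 :=
  h.inner_eq_zero_of_eigenvector hf₂ fun x => by
    rw [← ContinuousLinearMap.adjoint_inner_left, hf₁, inner_smul_left, RingHomCompTriple.comp_apply,
      RingHom.id_apply]

/-! ## One-parameter unitary groups: invariant vectors and eigenvectors -/

/-- **Virial theorem for the Koopman/propagator picture, frequency `0`**: if `U(t) ∈ C¹(A; H)` with
commutator `D = [U(t), iA]` and `f₁, f₂` are `U`-invariant vectors (the eigenspace `Ker H` of the
Stone Hamiltonian at `0`, `invariantVectors_eq_kernel_hamiltonian`), then `⟪f₁, D f₂⟫ = 0`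
(`U(t) f₂ = f₂`, `U(t)* f₁ = U(-t) f₁ = f₁`). [cite: AmreinBoutetdeMonvelGeorgescu1996, Prop. 7.2.10] -/
theorem inner_eq_zero_of_mem_invariantVectors_appReal (U : OneParameterUnitaryGroup H)
    {A : OneParameterUnitaryGroup H} {t : ℝ} {D : H →L[ℂ] H} (h : A.HasCommutator (U.appReal t) D)
    {f₁ f₂ : H} (hf₁ : f₁ ∈ U.invariantVectors) (hf₂ : f₂ ∈ U.invariantVectors) :
    ⟪f₁, D f₂⟫_ℂ = 0 := by
  refine h.inner_eq_zero_of_eigenvector (c := 1) ?_ fun x => ?_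
  · rw [one_smul]
    exact (U.mem_invariantVectors_iff f₂).1 hf₂ _
  · rw [one_mul, U.inner_appReal_apply_of_mem_invariantVectors hf₁]

/-- **Virial theorem for smeared operators**: if `U[k] = ∫ k(a) U(a) da ∈ C¹(A; H)` (`k`
integrable) with commutator `D`, and `f₁, f₂` are `U`-invariant, then `⟪f₁, D f₂⟫ = 0`
(`U[k] f₂ = (∫ k) f₂` and `⟪f₁, U[k] x⟫ = (∫ k) ⟪f₁, x⟫`). Covers every bounded function of `H`
realised through the group, in particular the resolvent. [cite: AmreinBoutetdeMonvelGeorgescu1996, Prop. 7.2.10] -/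
theorem inner_eq_zero_of_mem_invariantVectors_smear (U : OneParameterUnitaryGroup H)
    {A : OneParameterUnitaryGroup H} {k : ℝ → ℂ} (hk : Integrable k) {D : H →L[ℂ] H}
    (h : A.HasCommutator (U.smear k) D) {f₁ f₂ : H} (hf₁ : f₁ ∈ U.invariantVectors)
    (hf₂ : f₂ ∈ U.invariantVectors) : ⟪f₁, D f₂⟫_ℂ = 0 := by
  have hfix : ∀ a : ℝ, U.appReal a f₂ = f₂ := fun a => (U.mem_invariantVectors_iff f₂).1 hf₂ _
  refine h.inner_eq_zero_of_eigenvector (c := ∫ a, k a) ?_ fun x => ?_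
  · rw [U.smear_apply hk]
    simp_rw [hfix]
    exact integral_smul_const k f₂
  · rw [U.smear_apply hk, U.inner_integral_smul_appReal hk]
    simp_rw [U.inner_appReal_apply_of_mem_invariantVectors hf₁]
    exact integral_mul_const _ k

/-- **ABG's virial theorem at the eigenvalue `0`, in the tree's vocabulary**: if the Hamiltonian
`H` of `U(t) = e^{itH}` is of class `C¹(A)` (`HamiltonianOfClassC1`: its resolvent `(H + i)⁻¹` is in
`C¹(A; H)`), then the commutator `[(H + i)⁻¹, iA]` has vanishing matrix elements between
invariant vectors (= `Ker H`): `E({0}) [A, (H + i)⁻¹] E({0}) = 0`, which is Prop. 7.2.10 for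
`λ = 0` through (7.2.1)–(7.2.2). [cite: AmreinBoutetdeMonvelGeorgescu1996, Prop. 7.2.10] -/
theorem inner_commutator_resolventNegI_eq_zero (U : OneParameterUnitaryGroup H)
    {A : OneParameterUnitaryGroup H} (hH : U.HamiltonianOfClassC1 A) {f₁ f₂ : H}
    (hf₁ : f₁ ∈ U.invariantVectors) (hf₂ : f₂ ∈ U.invariantVectors) :
    ⟪f₁, A.commutatorCLM U.resolventNegI f₂⟫_ℂ = 0 :=
  U.inner_eq_zero_of_mem_invariantVectors_smear integrable_resolventKernel
    (IsOfClassC1.hasCommutator hH) hf₁ hf₂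

/-- **Virial theorem for an eigenvector of a unitary propagator** (Floquet / Koopman form): if
`U(t) ∈ C¹(A; H)` with commutator `D`, and `U(t) f₁ = c f₁`, `U(t) f₂ = c f₂` for one `t` and one
`c` (necessarily `|c| = 1` unless the vector vanishes, so that `U(t)* f₁ = c̄ f₁`), then
`⟪f₁, D f₂⟫ = 0`. [cite: AmreinBoutetdeMonvelGeorgescu1996, Prop. 7.2.10] -/
theorem inner_eq_zero_of_appReal_apply_eq_smul (U : OneParameterUnitaryGroup H)
    {A : OneParameterUnitaryGroup H} {t : ℝ} {D : H →L[ℂ] H} (h : A.HasCommutator (U.appReal t) D)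
    {f₁ f₂ : H} {c : ℂ} (hf₁ : U.appReal t f₁ = c • f₁) (hf₂ : U.appReal t f₂ = c • f₂) :
    ⟪f₁, D f₂⟫_ℂ = 0 := by
  by_cases h0 : f₁ = 0
  · rw [h0, inner_zero_left]
  -- `|c| = 1`, hence `U(-t) f₁ = c⁻¹ f₁ = c̄ f₁`
  have hc : ‖c‖ = 1 := by
    have h1 : ‖c‖ * ‖f₁‖ = ‖f₁‖ := by rw [← norm_smul, ← hf₁, norm_appReal]
    have h2 : ‖f₁‖ ≠ 0 := norm_ne_zero_iff.2 h0
    field_simp at h1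
    linarith [h1]
  have hc0 : c ≠ 0 := fun hc0 => by simp [hc0] at hc
  have hneg : U.appReal (-t) f₁ = conj c • f₁ := by
    have e := congrArg (U.appReal (-t)) hf₁
    rw [appReal_neg_apply_appReal, map_smul] at e
    rw [← inv_eq_conj hc, eq_inv_smul_iff₀ hc0]
    exact e.symm
  refine h.inner_eq_zero_of_eigenvector hf₂ fun x => ?_
  rw [inner_appReal_right, hneg, inner_smul_left, RingHomCompTriple.comp_apply, RingHom.id_apply]

end UnitaryRep

end Literature.Analysis.UnboundedOperators
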